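import Summits.QuantumFields.BalabanUV.Beta.GAN24.BornBorderDriftThree
import Summits.QuantumFields.BalabanUV.Beta.GAN24.BornBorderUndressedDrift

/-!
# GAN24 ∕ BORNSEC, V half — `BornBorderDriftAssembly`: **hBdev(cVH,0) OF THE `d = 3` COMB FAMILY ⟸ THE V CONTACT PAIR LETTERS (births `≥ 1`, sup currency) ALONE**
# (the V twin of leaf-06 g41's `BornLambdaDriftAssembly`; `d = 3`, `2 ≤ Lc`, pin `cE = Lc^4`, every `cVH`, every in-block root)

NOT IN PRINT; OUR BOOKKEEPING (G-an2-4 formalisation swarm → CRUX TEAM (2), leaf prover `b2b-balaban-gan24-formalise-leaf-04`, gen 57; journal `CLAIMS.log` INTENT 2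
«ROOTED-S3-V-DIFF», NEXT item).  [folklore] assembly BY NAME: the full top-aligned V pair `D(i+1,k+1) − D(i,k)` of PART 2's socket
`BornBorderDriftThree.exists_hBdevV_three_of_supPairs` splits POINTWISE as the undressed pair `U(i+1,k+1) − U(i,k)` — HYPOTHESIS-FREE by
`BornBorderUndressedDrift.exists_pairU_v_sup_three` (road S3's rooted symmetric-table DIFF rows dV ∕ dVt through the owner's exponent identities) — plus the CONTACT pair
`(D(i+1,k+1) − U(i+1,k+1)) − (D(i,k) − U(i,k))`, the ONE hypothesis `hPcV` (leaf-03's (V-C) cells with one slot differenced — «(V-C)-DIFF», leaf-03 g56, in flight; the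
display below is the socket's binder for it: `(k, i)` indexing, births `i ≥ 1`, weight exponent `k − i` on both members, sup currency, any exponent `q`).  0 `def`, 0 cited
facts, 0 `def … : Prop`, 0 sorry; NO estimate of Bałaban's.  HONEST FRAMING (cell contract, verbatim): «discharging `BetaPertH` makes Bałaban's UV stability UNCONDITIONAL — a
real constructive-QFT result; it is NOT the continuum limit and NOT the Clay problem.»  HONEST DEPENDENCY (verbatim): «continuum YM on T⁴ ⇐ BetaPertH ∧ nine spine estimates
(0/9 proved); BetaPertH ⇐ (D1) ∧ (D4) ∧ CAP+tail; G-an2-4 gates asym, D1 and NE2/3/4.»  HONEST: a SOCKET — hBdev(cVH,0) ⟸ `hPcV`; discharges NOTHING of (hS, hSall) on (E) by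
itself; NEVER «G-an2-4 closed» as (CONV-C); NOT D1, NOT BetaPertH, NOT continuum, NOT Clay.
Unit `b2b-balaban-gan24-formalise-leaf-04` (gen 57), 2026-08-21.
-/

noncomputable section

open Finset
open scoped BigOperators
open Literature.MathematicalPhysics.QuantumFieldTheory
open Literature.MathematicalPhysics.QuantumFieldTheory.Balaban1983to89
open Literature.MathematicalPhysics.QuantumFieldTheory.Balaban1983to89.Beta
open ExpKernelCalculus (MKer)
open OneStepResolventKernel (Fib LocStencil KInv)
open AffineAveraging (box toSite)
open AveragingHessianKernelsRooted (vhSAt)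
open BalabanCompositeJets (respStep)
open Summit.QuantumFields.BalabanUV.Beta.HessKerDressedUnits (unitS)
open Summit.QuantumFields.BalabanUV.Beta.GAN24.CombesThomas (sfStep smStep KStepUnit SupBound)
open Summit.QuantumFields.BalabanUV.Beta.GAN24.Push3 (push₃)
open Summit.QuantumFields.BalabanUV.Beta.GAN24.SrecLinearPartEq (colM rowMM reslot)
open Summit.QuantumFields.BalabanUV.Beta.GAN24.SrecWilsonSector (bornSecAt)
open Summit.QuantumFields.BalabanUV.Beta.GAN24.SrecBornSector (unitStepMap)
open Summit.QuantumFields.BalabanUV.Beta.GAN24.AffineUnroll (transport)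
open Summit.QuantumFields.BalabanUV.Beta.GAN24.BornBorderDriftThree (exists_hBdevV_three_of_supPairs)
open Summit.QuantumFields.BalabanUV.Beta.GAN24.BornBorderUndressedDrift (exists_pairU_v_sup_three)

namespace Summit.QuantumFields.BalabanUV.Beta.GAN24.BornBorderDriftAssembly

variable {Lc : ℕ} [NeZero Lc]

/-- NOT IN PRINT; OUR PROOF ATTEMPT — A SOCKET (`d = 3`, `2 ≤ Lc`, pin `cE = Lc^4`; [folklore] assembly).  **THE RATE HALF `hBdev(cVH,0)` OF THE V-BORN ROW OF THE `d = 3` COMB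
FAMILY FROM THE V CONTACT PAIR LETTERS (births `≥ 1`, SUP currency, NO decay asked) ALONE**: if for every in-block root, every `1 ≤ i < k` and every entry the CONTACT part of
member `k+1`'s lineage born at `i+1` minus that of member `k`'s born at `i` is bounded by `CPc·(k−i)^q·Θc^k` (`Θc < 1`), then the unit tables of `bornSecAt Lc ρ cE cVH 0` obey the
all-scales Cauchy letter `LocStencil (U_{k+j} − U_k) (cB·θB^k) δB` with ONE `cB`, ONE `θB < 1`, ONE `δB > 0` — the undressed pairs by `exists_pairU_v_sup_three` (road S3's rooted
DIFF rows), folded with the contact pairs into `(CU + CPc)·(k−i)^q·(max Θ Θc)^k`, then PART 2's socket.  `hPcV` is NOT proved here; NOT hSdev of the comb family;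
NEVER «G-an2-4 closed». -/
theorem exists_hBdevV_three_of_contactPairs (hLc : 2 ≤ Lc) {cE : ℝ} (hcE : cE = (Lc : ℝ) ^ (3 + 1)) (cVH : ℝ) (q : ℕ)
    (hPcV : ∃ CPc Θc : ℝ, 0 ≤ CPc ∧ 0 ≤ Θc ∧ Θc < 1 ∧ ∀ (rr : Fin (3 + 1) → ℕ), rr ∈ box (3 + 1) Lc → ∀ k i : ℕ, 1 ≤ i → i < k → ∀ κ u,
      SupBound
        ((( transport (unitStepMap Lc (toSite rr) cE) (i + 1 + 1) (k - 1 - i)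
              (unitStepMap Lc (toSite rr) cE (i + 1) (fun κ u => cVH • vhSAt (toSite rr) 3 Lc rfl κ u))
            - fun κ' u' => (cE * (Lc : ℝ) ^ (2 * (3 + 1))) ^ (k - i) •
              push₃ (respStep (d := 3) (Lc ^ (i + 1 + 1)) (Lc ^ (k + 1))) (respStep (d := 3) (Lc ^ (i + 1 + 1)) (Lc ^ (k + 1)))
                (respStep (d := 3) (Lc ^ (i + 1 + 1)) (Lc ^ (k + 1)))
                (fun κ u => -(push₃ (-respStep (d := 3) (Lc ^ (i + 1)) (Lc ^ (i + 1 + 1))) (colM (KStepUnit (d := 3) Lc (i + 1)) Lc)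
                      (respStep (d := 3) (Lc ^ (i + 1)) (Lc ^ (i + 1 + 1))) (reslot Sum.inl Sum.inr fun κ u => cVH • vhSAt (toSite rr) 3 Lc rfl κ u) κ u
                  + push₃ (rowMM (KStepUnit (d := 3) Lc (i + 1)) Lc) (respStep (d := 3) (Lc ^ (i + 1)) (Lc ^ (i + 1 + 1)))
                      (respStep (d := 3) (Lc ^ (i + 1)) (Lc ^ (i + 1 + 1))) (reslot Sum.inr Sum.inl fun κ u => cVH • vhSAt (toSite rr) 3 Lc rfl κ u) κ u))
                κ' u')
          - ( transport (unitStepMap Lc (toSite rr) cE) (i + 1) (k - 1 - i)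
              (unitStepMap Lc (toSite rr) cE i (fun κ u => cVH • vhSAt (toSite rr) 3 Lc rfl κ u))
            - fun κ' u' => (cE * (Lc : ℝ) ^ (2 * (3 + 1))) ^ (k - i) •
              push₃ (respStep (d := 3) (Lc ^ (i + 1)) (Lc ^ k)) (respStep (d := 3) (Lc ^ (i + 1)) (Lc ^ k)) (respStep (d := 3) (Lc ^ (i + 1)) (Lc ^ k))
                (fun κ u => -(push₃ (-respStep (d := 3) (Lc ^ i) (Lc ^ (i + 1))) (colM (KStepUnit (d := 3) Lc i) Lc)
                      (respStep (d := 3) (Lc ^ i) (Lc ^ (i + 1))) (reslot Sum.inl Sum.inr fun κ u => cVH • vhSAt (toSite rr) 3 Lc rfl κ u) κ u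
                  + push₃ (rowMM (KStepUnit (d := 3) Lc i) Lc) (respStep (d := 3) (Lc ^ i) (Lc ^ (i + 1)))
                      (respStep (d := 3) (Lc ^ i) (Lc ^ (i + 1))) (reslot Sum.inr Sum.inl fun κ u => cVH • vhSAt (toSite rr) 3 Lc rfl κ u) κ u))
                κ' u')) κ u)
        (CPc * ((((k - i : ℕ) : ℝ)) ^ q * Θc ^ k))) :
    ∃ cB θB δB : ℝ, 0 ≤ cB ∧ 0 ≤ θB ∧ θB < 1 ∧ 0 < δB ∧ ∀ (rr : Fin (3 + 1) → ℕ), rr ∈ box (3 + 1) Lc → ∀ k j : ℕ,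
      LocStencil (unitS (sfStep Lc (k + j)) (smStep 3 Lc (k + j)) (bornSecAt Lc (toSite rr) cE cVH 0 (k + j))
        - unitS (sfStep Lc k) (smStep 3 Lc k) (bornSecAt Lc (toSite rr) cE cVH 0 k)) (cB * θB ^ k) δB := by
  obtain ⟨CU, Θ, hCU, hΘ0, hΘ1, hU⟩ := exists_pairU_v_sup_three (Lc := Lc) hLc hcE cVH
  obtain ⟨CPc, Θc, hCPc, hΘc0, hΘc1, hC⟩ := hPcV
  set Θ' : ℝ := max Θ Θc with hΘ'
  have hΘ'0 : 0 ≤ Θ' := le_max_of_le_left hΘ0.le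
  have hΘ'1 : Θ' < 1 := max_lt hΘ1 hΘc1
  refine exists_hBdevV_three_of_supPairs hLc hcE cVH q ⟨CU + CPc, Θ', by positivity, hΘ'0, hΘ'1, fun rr hrr k i hi hik κ u x z a b => ?_⟩
  have h1 := hU rr hrr k i hi hik κ u x z a b
  have h2 := hC rr hrr k i hi hik κ u x z a b
  simp only [Pi.sub_apply] at h1 h2 ⊢
  -- pointwise: `D′ − D = (U′ − U) + ((D′ − U′) − (D − U))`
  have e : ∀ D' U' D U : ℝ, D' - D = (U' - U) + ((D' - U') - (D - U)) := fun _ _ _ _ => by ring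
  rw [e]
  refine (abs_add_le _ _).trans ((add_le_add h1 h2).trans ?_)
  -- `CU Θ^k + CPc (k−i)^q Θc^k ≤ (CU + CPc) (k−i)^q Θ'^k` since `k − i ≥ 1`
  have hki : (1 : ℝ) ≤ (((k - i : ℕ) : ℝ)) := by exact_mod_cast Nat.sub_pos_of_lt hik
  have hq1 : (1 : ℝ) ≤ (((k - i : ℕ) : ℝ)) ^ q := one_le_pow₀ hki
  have hΘk : Θ ^ k ≤ Θ' ^ k := pow_le_pow_left₀ hΘ0.le (le_max_left _ _) k
  have hΘck : Θc ^ k ≤ Θ' ^ k := pow_le_pow_left₀ hΘc0 (le_max_right _ _) k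
  have hΘ'k : 0 ≤ Θ' ^ k := pow_nonneg hΘ'0 k
  have hq0 : 0 ≤ (((k - i : ℕ) : ℝ)) ^ q := by positivity
  calc CU * Θ ^ k + CPc * ((((k - i : ℕ) : ℝ)) ^ q * Θc ^ k)
      ≤ CU * ((((k - i : ℕ) : ℝ)) ^ q * Θ' ^ k) + CPc * ((((k - i : ℕ) : ℝ)) ^ q * Θ' ^ k) := by
        refine add_le_add (mul_le_mul_of_nonneg_left ?_ hCU) (mul_le_mul_of_nonneg_left (mul_le_mul_of_nonneg_left hΘck hq0) hCPc)
        calc Θ ^ k ≤ Θ' ^ k := hΘk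
          _ = 1 * Θ' ^ k := (one_mul _).symm
          _ ≤ (((k - i : ℕ) : ℝ)) ^ q * Θ' ^ k := mul_le_mul_of_nonneg_right hq1 hΘ'k
    _ = (CU + CPc) * ((((k - i : ℕ) : ℝ)) ^ q * Θ' ^ k) := by ring

end Summit.QuantumFields.BalabanUV.Beta.GAN24.BornBorderDriftAssembly

end
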